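import Literature.AlgebraicGeometry.AbelianSchemes.SerreTensorConstruction
import Literature.AlgebraicGeometry.Morphisms.ProjectiveMorphismComposition
import HarnessLib

/-!
# Powers `Aⁿ` and Serre tensors `A ⊗_𝒪 𝔟` of a PROJECTIVE abelian scheme are projective over the base
# ([Hartshorne1977] II Ex. 4.9; [MumfordFogartyKirwan1994] Ch. 6 §1 Def. 6.1; [Conrad2004GrossZagier] §7)

Layer `Literature/AlgebraicGeometry/AbelianSchemes`, namespace `Literature.AlgebraicGeometry.AbelianSchemes.AbelianSchemeOver`.  THEOREMS ONLY (no definition,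
no named fact, no instance, no notation, no `sorry`).  Cell `hodgecm-mathlib` (D-0151), P6 «MOD programme», X-leaf `stub_ESHEET`, organ (M1) «dual pairs of the
Serre twist over `X`» (LA7-p01 (g3) LEGPLAN v1 §3, payer LA6-p02 (g2)) — PIECE 1: the projectivity input `hproj` of ★
`MumfordDual.nonempty_dualPair_of_charts_of_isProjective_of_isUnit′` for `B := A ⊗_𝒪 𝔟 = Fix([E] ↷ Aᵐ)`:
* `isProjective_pow_succ_hom` — `Aᵐ⁺¹ → S` is projective when `A → S` is (fibre products of projective morphisms, ★ `IsProjective.tensorObj_hom`, by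
  induction from `A¹ = S ×_S A`, ★ `IsProjective.pullback_fst`);
* **`isProjective_serreTensor_hom`** — `A ⊗_𝒪 𝔟 → S` is projective for `m ≥ 1`: it is the CLOSED subgroup scheme `Fix([E])` of `Aᵐ` (★
  `isClosedImmersion_fixedι_left`, ★ `fixedOver_hom`) and a closed immersion followed by a projective morphism is projective (★
  `IsProjective.comp_isClosedImmersion`).
`--supports stmt-HodgeConjecture-24832`, count-neutral; HC_CM is proved only modulo the printed citations until rung 0 closes.

## References
* [Hartshorne1977] R. Hartshorne, *Algebraic Geometry* (1977), II §4 Definition (projective morphism, p. 103) and Ex. 4.9 (p. 105).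
* [MumfordFogartyKirwan1994] D. Mumford, J. Fogarty, F. Kirwan, *Geometric Invariant Theory*, 3rd ed. (1994), Ch. 6 §1 Definition 6.1 (p. 115).
* [Conrad2004GrossZagier] B. Conrad, *Gross–Zagier revisited*, MSRI Publ. 49 (2004), §7 (Serre's tensor construction, Thm. 7.5).
-/

set_option autoImplicit false

noncomputable section

open CategoryTheory CategoryTheory.Limits AlgebraicGeometry MonoidalCategory CartesianMonoidalCategory
open scoped MonObj
open Literature.AlgebraicGeometry.Morphisms (IsProjective)

universe u

namespace Literature.AlgebraicGeometry.AbelianSchemes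

namespace AbelianSchemeOver

variable {S : Scheme.{u}} (A : AbelianSchemeOver S)

/-- Composing with a morphism EQUAL to the identity keeps projectivity (bookkeeping for `(𝟙_ (Over S)).hom = 𝟙 S`). [cite: Hartshorne1977, II §4 Definition p. 103] -/
private theorem isProjective_comp_of_eq_id {X Y : Scheme.{u}} {p : X ⟶ Y} (hp : IsProjective p) {e : Y ⟶ Y} (he : e = 𝟙 Y) :
    IsProjective (p ≫ e) := by
  subst he
  rw [Category.comp_id]
  exact hp

/-- **`Aᵐ⁺¹ → S` is projective when `A → S` is** (`A¹ = S ×_S A` is the base change of `A` along `𝟙 S`; `Aᵐ⁺² = Aᵐ⁺¹ ×_S A` a fibre product of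
projective `S`-schemes, [Hartshorne1977] II Ex. 4.9). [cite: Hartshorne1977, II Ex. 4.9 (p. 105)] [cite: MumfordFogartyKirwan1994, Ch. 6 §1 Definition 6.1 (p. 115)] -/
theorem isProjective_pow_succ_hom (hA : IsProjective A.X.hom) : ∀ m : ℕ, IsProjective (A.pow (m + 1)).X.hom
  | 0 => by
      change IsProjective (pullback.fst (𝟙_ (Over S)).hom A.X.hom ≫ (𝟙_ (Over S)).hom)
      exact isProjective_comp_of_eq_id (IsProjective.pullback_fst (𝟙_ (Over S)).hom hA) (Over.tensorUnit_hom)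
  | m + 1 => IsProjective.tensorObj_hom (isProjective_pow_succ_hom hA m) hA

variable {A} {O : Type*} [CommRing O] (act : A.RingAction O) [IsCommMonObj A.X]

/-- **The Serre tensor `A ⊗_𝒪 𝔟 → S` is projective** for a projective `A → S` and an idempotent `E ∈ M_m(𝒪)` with `m ≥ 1`: `A ⊗_𝒪 𝔟 = Fix([E] ↷ Aᵐ)` is a CLOSED
subgroup scheme of the projective `Aᵐ` ([Conrad2004GrossZagier] §7: Serre's construction inside `Aᵐ`; [Hartshorne1977] II §4: closed immersion ≫ projective
is projective).  The `hproj` input of ★ `MumfordDual.dualPairOfAmpleRigidified` for the Serre twist. [cite: Conrad2004GrossZagier, §7 (Thm. 7.5)]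
[cite: Hartshorne1977, II §4 Definition p. 103 and Ex. 4.9 (p. 105)] -/
theorem isProjective_serreTensor_hom (hA : IsProjective A.X.hom) {m : ℕ} (hm : m ≠ 0) (E : Matrix (Fin m) (Fin m) O) (hE : E * E = E) :
    IsProjective (serreTensor act E hE).X.hom := by
  obtain ⟨k, rfl⟩ := Nat.exists_eq_succ_of_ne_zero hm
  haveI : IsClosedImmersion (serreι act E hE).left := by
    haveI := isMonHom_matrixEnd act E
    exact isClosedImmersion_fixedι_left (matrixEnd act E)
  rw [← Over.w (serreι act E hE)]
  exact (A.isProjective_pow_succ_hom hA k).comp_isClosedImmersion _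

end AbelianSchemeOver

end Literature.AlgebraicGeometry.AbelianSchemes

end
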